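import Literature.MathematicalPhysics.StatisticalMechanics.MuGroundStateConfiguration
import Summits.AtomisticToContinuum.Crystallization.Theorems.ChargedEnergyGap.Negative.BlocksBound
import Summits.AtomisticToContinuum.Crystallization.Theorems.LayeredLawsSelectHcp.Negative.PeriodicEnergy
import Summits.AtomisticToContinuum.Crystallization.Theorems.ExcessDecayLiouvilleFarField
import Summits.AtomisticToContinuum.Crystallization.Theses.GrainCoreNetworkSplit

/-!
# FrustratedLawDichotomy · crux `AperiodicFrustratedLawGap` (stmt-AtomisticToContinuum-27623) — TRUNCATED (FINITE) SURGERY CERTIFICATES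
# (decomp-a2c, prover hand 2, structural share, generation 5)

`FrustratedLawDichotomyGSCSurgeryTests` turns Sütő's μGSC property into finite-surgery tests, but their field terms
`I(z) = Σ'_{y ∈ X ∖ xf} V_LJ(dist z y)` are infinite series.  A census computes TRUNCATED fields
`I_{≤Rc}(z) = Σ_{y ∈ X ∖ xf, dist z y ≤ Rc} V_LJ(dist z y)`.  For a `δ`-separated `X ⊆ ℝ³` the `r⁻⁶` tail is explicit
(dyadic shells, tree lemma `ExcessDecayLiouville.sum_inv_pow_le_of_separated`, and `|V_LJ(t)| ≤ (δ⁻⁶/12 + 1/6)·t⁻⁶` for `t ≥ δ`):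

* `abs_tsum_lennardJones_sub_sum_le` : `|I(z) − I_{≤Rc}(z)| ≤ T(δ, Rc) := (δ⁻⁶/12 + 1/6)·1024/(δ³·Rc³)` for every point `z` (in `X` or not),
  every `Y ⊆ X` and every `Rc ≥ δ`, the near part being handed over as an explicit `Finset`;
* `not_isMuGSC_of_truncated_surgery` : a finite surgery (remove `xf`, `n` atoms; insert `R`, `k` atoms) whose TRUNCATED balance satisfies
  `Δ_{≤Rc} + (n + k)·T(δ, Rc) < μ·(k − n)` refutes `IsMuGSC V_LJ μ X`;
* `not_isMuGSC_eStar_of_truncated_netRemoval` : at `μ = e⋆` with `k ≤ n`, `Δ_{≤Rc} + (n + k)·T(δ, Rc) < e_up·(k − n)` for a periodic witness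
  `e(Q) ≤ e_up` suffices (only an UPPER bound on `e⋆`);
* `eStar_lt_energyPerParticle_of_truncated_surgery` : for a `δ`-separated periodic candidate `Q` (granted `MuEquilibriumDoor`), a truncated
  balance `Δ_{≤Rc} + (n + k)·T(δ, Rc) < e(Q)·(k − n)` on `Q − x` certifies `e⋆ < e(Q)`.

Numerics of the tail: `T(1, Rc) = 256·Rc⁻³` (`Rc = 20`: `0.032`; `Rc = 40`: `0.004` per field term), `T(7/10, Rc) ≈ 3.7·10³·Rc⁻³`; the constant
is crude (dyadic shell counting) and the census should use the separation `δ` of the actual candidate.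
All `[folklore]`.  (Route-independent imports: the two bookkeeping steps of `FrustratedLawDichotomyGSCSurgeryTests` that are needed — the surgery
balance of a μGSC and the door at a periodic Palm law — are re-derived in place, so that this file does not sit in that module's cone.)
-/

noncomputable section

namespace Summit.AtomisticToContinuum.Crystallization.Theorems.FrustratedLawDichotomyGSCSurgeryCertificates

open MeasureTheory
open Literature.MathematicalPhysics.StatisticalMechanics
open Summit.AtomisticToContinuum.Crystallization.Theorems.ChargedEnergyGapNegative (E3 eStar eStar_le)
open Literature.Probability.Process (count_restrict_singleton_ne_zero_iff)
open Summit.AtomisticToContinuum.Crystallization.Theorems.LayeredLawsSelectHcp.Negative.PeriodicPalmLaw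
  (palmLaw view viewMeasure view_separated rooted_palmLaw pointStationary_palmLaw of_ae_palmLaw)
open Summit.AtomisticToContinuum.Crystallization.Theorems.LayeredLawsSelectHcp.Negative.PeriodicEnergy (meanRootEnergy_palmLaw)
open Summit.AtomisticToContinuum.Crystallization.Theorems.ExcessDecayLiouville (sum_inv_pow_le_of_separated)

variable {X Y : Set E3} {δ : ℝ}

/-! ## §0. Two bookkeeping steps (re-derived, see the module docstring) -/

/-- Surgery balance of a `μ`GSC, contrapositive: a finite surgery with balance `Δ < μ·(k − n)` refutes `IsMuGSC V μ X`.
[cite: Suto2006, §2 Definition (μGSC, second form)] -/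
theorem not_isMuGSC_of_balance_lt {μ : ℝ} {n : ℕ} {xf : Fin n → E3} (hxf : Function.Injective xf) (hX : Set.range xf ⊆ X)
    {k : ℕ} {R : Fin k → E3} (hR : Function.Injective R) (hdisj : Disjoint (Set.range R) (X \ Set.range xf))
    (hΔ : (interactionEnergy lennardJones R + ∑ i, ∑' y : ↥(X \ Set.range xf), lennardJones (dist (R i) y)) -
        (interactionEnergy lennardJones xf + ∑ i, ∑' y : ↥(X \ Set.range xf), lennardJones (dist (xf i) y)) < μ * ((k : ℝ) - n)) :
    ¬ IsMuGSC lennardJones μ X := fun h => by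
  have := h.le hxf hX hR hdisj
  rw [mul_sub] at hΔ
  linarith

/-- The door at the Palm law of a periodic configuration: granted `MuEquilibriumDoor`, a `δ`-separated periodic `Q` with `e(Q) ≤ e⋆` is an
`e⋆`-μGSC seen from every motif point. [folklore] -/
theorem isMuGSC_view_of_le (Q : PeriodicConfiguration 3)
    (hDoor : Summit.AtomisticToContinuum.Crystallization.Theses.GrainCoreNetworkSplit.MuEquilibriumDoor)
    (hδ : 0 < δ) (hsep : ∀ p ∈ Q.points, ∀ q ∈ Q.points, p ≠ q → δ ≤ dist p q)
    (hopt : Q.energyPerParticle lennardJones ≤ ⨅ Q' : PeriodicConfiguration 3, Q'.energyPerParticle lennardJones) :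
    ∀ x ∈ Q.motif, IsMuGSC lennardJones (⨅ Q' : PeriodicConfiguration 3, Q'.energyPerParticle lennardJones) (view Q x) := by
  have hE : ∫ μ, rootEnergy lennardJones μ ∂(palmLaw Q) = Q.energyPerParticle lennardJones := by
    rw [← meanRootEnergy_palmLaw Q]; rfl
  have hg := hDoor δ hδ (palmLaw Q) inferInstance (rooted_palmLaw Q hsep) (pointStationary_palmLaw Q) (hE.le.trans hopt)
  have hg' : ∀ᵐ μ ∂(palmLaw Q),
      IsMuGSC lennardJones (⨅ Q' : PeriodicConfiguration 3, Q'.energyPerParticle lennardJones) {p : E3 | μ {p} ≠ 0} :=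
    hg.mono fun μ hμ => hμ
  intro x hx
  have hv := of_ae_palmLaw Q hg' x hx
  have hset : {p : E3 | viewMeasure Q x {p} ≠ 0} = view Q x := Set.ext fun p => count_restrict_singleton_ne_zero_iff (view Q x) p
  rwa [hset] at hv

/-! ## §1. The explicit `r⁻⁶` tail of a Lennard-Jones field over a separated set -/

/-- A `δ`-separated subset of `ℝ³` is uniformly discrete, so every Lennard-Jones field over it is summable. [folklore] -/
theorem summable_lennardJones_field (hδ : 0 < δ) (hsep : ∀ a ∈ X, ∀ b ∈ X, a ≠ b → δ ≤ dist a b) (hYX : Y ⊆ X) (z : E3) :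
    Summable fun y : ↥Y => lennardJones (dist z y) := by
  have hY : UniformlyDiscrete Y := ⟨δ, hδ, fun a ha b hb hab => hsep a (hYX ha) b (hYX hb) hab⟩
  exact hY.summable_lennardJones_dist z

/-- **THE TRUNCATION TAIL.**  For a `δ`-separated `X ⊆ ℝ³`, `Y ⊆ X`, any point `z` and `Rc ≥ δ`: if `t` is the (finite) set of points of
`Y` within `Rc` of `z`, then `|Σ'_{y ∈ Y} V_LJ(dist z y) − Σ_{y ∈ t} V_LJ(dist z y)| ≤ (δ⁻⁶/12 + 1/6)·1024/(δ³·Rc³)`. [folklore] -/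
theorem abs_tsum_lennardJones_sub_sum_le (hδ : 0 < δ) (hsep : ∀ a ∈ X, ∀ b ∈ X, a ≠ b → δ ≤ dist a b) (hYX : Y ⊆ X)
    (z : E3) {Rc : ℝ} (hRc : δ ≤ Rc) (t : Finset E3) (ht : ∀ y : E3, y ∈ t ↔ y ∈ Y ∧ dist z y ≤ Rc) :
    |∑' y : ↥Y, lennardJones (dist z y) - ∑ y ∈ t, lennardJones (dist z y)| ≤
      (δ⁻¹ ^ 6 / 12 + 1 / 6) * (1024 / (δ ^ 3 * Rc ^ 3)) := by
  classical
  set g : E3 → ℝ := Y.indicator fun y => lennardJones (dist z y) with hg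
  have hsumY := summable_lennardJones_field hδ hsep hYX z
  -- the series over `Y` as a series over `E3` of the indicator
  have hgsum : Summable g := by
    rw [hg, ← summable_subtype_iff_indicator]
    exact hsumY
  have htsum : ∑' y : ↥Y, lennardJones (dist z y) = ∑' y, g y := by
    rw [hg]; exact tsum_subtype Y (fun y => lennardJones (dist z y))
  -- split off the finite near part
  have hsplit := hgsum.sum_add_tsum_compl (s := t)
  have hnear : ∑ y ∈ t, g y = ∑ y ∈ t, lennardJones (dist z y) :=
    Finset.sum_congr rfl fun y hy => by rw [hg, Set.indicator_of_mem ((ht y).1 hy).1]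
  have hfar_eq : ∑' y : ↥Y, lennardJones (dist z y) - ∑ y ∈ t, lennardJones (dist z y) = ∑' y : ↥((↑t : Set E3)ᶜ), g y := by
    rw [htsum, ← hsplit, hnear]; ring
  rw [hfar_eq]
  -- the far part: every finite partial sum of `|g|` is a two-scale shell sum
  have hgabs : Summable fun y : ↥((↑t : Set E3)ᶜ) => |g y| := (hgsum.subtype _).abs
  have habs : |∑' y : ↥((↑t : Set E3)ᶜ), g y| ≤ ∑' y : ↥((↑t : Set E3)ᶜ), |g y| := by
    have h0 : Summable fun y : ↥((↑t : Set E3)ᶜ) => ‖g y‖ := (hgsum.subtype ((↑t : Set E3)ᶜ)).norm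
    have := norm_tsum_le_tsum_norm h0
    simpa only [Real.norm_eq_abs] using this
  refine habs.trans (hgabs.tsum_le_of_sum_le fun u => ?_)
  -- restrict the partial sum to the points of `Y` (elsewhere `g = 0`)
  set u' : Finset E3 := (u.image Subtype.val).filter (fun y => y ∈ Y) with hu'
  have hmem : ∀ y ∈ u', y ∈ Y ∧ Rc < dist z y := fun y hy => by
    rw [hu', Finset.mem_filter, Finset.mem_image] at hy
    obtain ⟨⟨w, hwt, rfl⟩, hyY⟩ := hy
    have hw : (w : E3) ∉ t := w.2
    refine ⟨hyY, ?_⟩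
    by_contra hle
    exact hw ((ht w).2 ⟨hyY, not_lt.1 hle⟩)
  have hsum_eq : ∑ y ∈ u, |g y| = ∑ y ∈ u', |lennardJones (dist z y)| := by
    rw [hu', Finset.sum_filter, Finset.sum_image (fun a _ b _ h => Subtype.ext h)]
    refine Finset.sum_congr rfl fun w _ => ?_
    by_cases hwY : (w : E3) ∈ Y
    · rw [if_pos hwY, hg, Set.indicator_of_mem hwY]
    · rw [if_neg hwY, hg, Set.indicator_of_notMem hwY, abs_zero]
  rw [hsum_eq]
  have hsep' : ∀ a ∈ u', ∀ b ∈ u', a ≠ b → δ ≤ dist a b := fun a ha b hb hab =>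
    hsep a (hYX (hmem a ha).1) b (hYX (hmem b hb).1) hab
  have hfar : ∀ y ∈ u', Rc ≤ dist y z := fun y hy => by rw [dist_comm]; exact (hmem y hy).2.le
  have h6 : ∑ y ∈ u', (dist y z)⁻¹ ^ (3 + 3) ≤ 1024 / (δ ^ 3 * Rc ^ 3) :=
    sum_inv_pow_le_of_separated u' z (k := 3) (by norm_num) hδ hRc hsep' hfar
  have hterm : ∀ y ∈ u', |lennardJones (dist z y)| ≤ (δ⁻¹ ^ 6 / 12 + 1 / 6) * (dist y z)⁻¹ ^ (3 + 3) := fun y hy => by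
    rw [dist_comm]
    exact abs_lennardJones_le_of_le hδ (hRc.trans (hfar y hy))
  calc ∑ y ∈ u', |lennardJones (dist z y)| ≤ ∑ y ∈ u', (δ⁻¹ ^ 6 / 12 + 1 / 6) * (dist y z)⁻¹ ^ (3 + 3) :=
        Finset.sum_le_sum hterm
    _ = (δ⁻¹ ^ 6 / 12 + 1 / 6) * ∑ y ∈ u', (dist y z)⁻¹ ^ (3 + 3) := by rw [Finset.mul_sum]
    _ ≤ (δ⁻¹ ^ 6 / 12 + 1 / 6) * (1024 / (δ ^ 3 * Rc ^ 3)) := mul_le_mul_of_nonneg_left h6 (by positivity)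

/-! ## §2. Truncated surgery certificates -/

/-- One truncated field term: `I(z) ≤ I_{≤Rc}(z) + T` and `I_{≤Rc}(z) − T ≤ I(z)`. [folklore] -/
theorem tsum_le_sum_add_tail (hδ : 0 < δ) (hsep : ∀ a ∈ X, ∀ b ∈ X, a ≠ b → δ ≤ dist a b) (hYX : Y ⊆ X)
    (z : E3) {Rc : ℝ} (hRc : δ ≤ Rc) (t : Finset E3) (ht : ∀ y : E3, y ∈ t ↔ y ∈ Y ∧ dist z y ≤ Rc) :
    ∑' y : ↥Y, lennardJones (dist z y) ≤ ∑ y ∈ t, lennardJones (dist z y) + (δ⁻¹ ^ 6 / 12 + 1 / 6) * (1024 / (δ ^ 3 * Rc ^ 3)) ∧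
    ∑ y ∈ t, lennardJones (dist z y) - (δ⁻¹ ^ 6 / 12 + 1 / 6) * (1024 / (δ ^ 3 * Rc ^ 3)) ≤ ∑' y : ↥Y, lennardJones (dist z y) := by
  have h := abs_tsum_lennardJones_sub_sum_le hδ hsep hYX z hRc t ht
  rw [abs_le] at h
  constructor <;> linarith [h.1, h.2]

/-- **TRUNCATED SURGERY CERTIFICATE** (any `μ`).  `X ⊆ ℝ³` `δ`-separated; surgery: remove the `n` distinct atoms `xf ⊆ X`, insert the `k`
distinct atoms `R` off `X ∖ xf`; truncation radius `Rc ≥ δ`; `tf i` / `tR i` the atoms of `X ∖ xf` within `Rc` of `xf i` / `R i`.  If the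
TRUNCATED balance, loaded with one tail per field term, is below `μ·(k − n)`:
`[U(R) + Σ_i I_{≤Rc}(R i)] − [U(xf) + Σ_i I_{≤Rc}(xf i)] + (n + k)·T(δ, Rc) < μ·(k − n)`, then `X` is not a `μ`GSC of `V_LJ`. [folklore] -/
theorem not_isMuGSC_of_truncated_surgery {μ : ℝ} (hδ : 0 < δ) (hsep : ∀ a ∈ X, ∀ b ∈ X, a ≠ b → δ ≤ dist a b)
    {n : ℕ} {xf : Fin n → E3} (hxf : Function.Injective xf) (hX : Set.range xf ⊆ X)
    {k : ℕ} {R : Fin k → E3} (hR : Function.Injective R) (hdisj : Disjoint (Set.range R) (X \ Set.range xf))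
    {Rc : ℝ} (hRc : δ ≤ Rc) (tf : Fin n → Finset E3) (htf : ∀ i, ∀ y : E3, y ∈ tf i ↔ y ∈ X \ Set.range xf ∧ dist (xf i) y ≤ Rc)
    (tR : Fin k → Finset E3) (htR : ∀ i, ∀ y : E3, y ∈ tR i ↔ y ∈ X \ Set.range xf ∧ dist (R i) y ≤ Rc)
    (hΔ : (interactionEnergy lennardJones R + ∑ i, ∑ y ∈ tR i, lennardJones (dist (R i) y)) -
        (interactionEnergy lennardJones xf + ∑ i, ∑ y ∈ tf i, lennardJones (dist (xf i) y)) +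
        ((n : ℝ) + k) * ((δ⁻¹ ^ 6 / 12 + 1 / 6) * (1024 / (δ ^ 3 * Rc ^ 3))) < μ * ((k : ℝ) - n)) :
    ¬ IsMuGSC lennardJones μ X := by
  set T : ℝ := (δ⁻¹ ^ 6 / 12 + 1 / 6) * (1024 / (δ ^ 3 * Rc ^ 3)) with hT
  have hYX : X \ Set.range xf ⊆ X := fun _ hy => hy.1
  -- each inserted field term is at most its truncation plus the tail
  have hRle : ∑ i, ∑' y : ↥(X \ Set.range xf), lennardJones (dist (R i) y) ≤ ∑ i, ∑ y ∈ tR i, lennardJones (dist (R i) y) + k * T := by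
    have h1 : ∑ i, ∑' y : ↥(X \ Set.range xf), lennardJones (dist (R i) y) ≤ ∑ i, (∑ y ∈ tR i, lennardJones (dist (R i) y) + T) :=
      Finset.sum_le_sum fun i _ => (tsum_le_sum_add_tail hδ hsep hYX (R i) hRc (tR i) (htR i)).1
    rw [Finset.sum_add_distrib, Finset.sum_const, Finset.card_univ, Fintype.card_fin, nsmul_eq_mul] at h1
    exact h1
  -- each removed field term is at least its truncation minus the tail
  have hfle : ∑ i, ∑ y ∈ tf i, lennardJones (dist (xf i) y) - n * T ≤ ∑ i, ∑' y : ↥(X \ Set.range xf), lennardJones (dist (xf i) y) := by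
    have h1 : ∑ i, (∑ y ∈ tf i, lennardJones (dist (xf i) y) - T) ≤ ∑ i, ∑' y : ↥(X \ Set.range xf), lennardJones (dist (xf i) y) :=
      Finset.sum_le_sum fun i _ => (tsum_le_sum_add_tail hδ hsep hYX (xf i) hRc (tf i) (htf i)).2
    rw [Finset.sum_sub_distrib, Finset.sum_const, Finset.card_univ, Fintype.card_fin, nsmul_eq_mul] at h1
    exact h1
  refine not_isMuGSC_of_balance_lt hxf hX hR hdisj (lt_of_le_of_lt ?_ hΔ)
  rw [hT] at hRle hfle
  nlinarith [hRle, hfle]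

/-- **TRUNCATED NET-REMOVAL CERTIFICATE at `μ = e⋆`** (`k ≤ n`, only an UPPER bound `e(Q) ≤ e_up` on `e⋆`). [folklore] -/
theorem not_isMuGSC_eStar_of_truncated_netRemoval {e_up : ℝ} (hup : ∃ Q : PeriodicConfiguration 3, Q.energyPerParticle lennardJones ≤ e_up)
    (hδ : 0 < δ) (hsep : ∀ a ∈ X, ∀ b ∈ X, a ≠ b → δ ≤ dist a b)
    {n : ℕ} {xf : Fin n → E3} (hxf : Function.Injective xf) (hX : Set.range xf ⊆ X)
    {k : ℕ} {R : Fin k → E3} (hR : Function.Injective R) (hdisj : Disjoint (Set.range R) (X \ Set.range xf)) (hkn : k ≤ n)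
    {Rc : ℝ} (hRc : δ ≤ Rc) (tf : Fin n → Finset E3) (htf : ∀ i, ∀ y : E3, y ∈ tf i ↔ y ∈ X \ Set.range xf ∧ dist (xf i) y ≤ Rc)
    (tR : Fin k → Finset E3) (htR : ∀ i, ∀ y : E3, y ∈ tR i ↔ y ∈ X \ Set.range xf ∧ dist (R i) y ≤ Rc)
    (hΔ : (interactionEnergy lennardJones R + ∑ i, ∑ y ∈ tR i, lennardJones (dist (R i) y)) -
        (interactionEnergy lennardJones xf + ∑ i, ∑ y ∈ tf i, lennardJones (dist (xf i) y)) +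
        ((n : ℝ) + k) * ((δ⁻¹ ^ 6 / 12 + 1 / 6) * (1024 / (δ ^ 3 * Rc ^ 3))) < e_up * ((k : ℝ) - n)) :
    ¬ IsMuGSC lennardJones (⨅ Q : PeriodicConfiguration 3, Q.energyPerParticle lennardJones) X := by
  refine not_isMuGSC_of_truncated_surgery hδ hsep hxf hX hR hdisj hRc tf htf tR htR (hΔ.trans_le ?_)
  have hkn' : ((k : ℝ) - n) ≤ 0 := by
    have : (k : ℝ) ≤ n := by exact_mod_cast hkn
    linarith
  obtain ⟨Q, hQ⟩ := hup
  exact mul_le_mul_of_nonpos_right ((eStar_le Q).trans hQ) hkn'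

/-- **TRUNCATED CENSUS TEST FOR A PERIODIC CANDIDATE (granted the door).**  `Q` periodic and `δ`-separated (`δ > 0`), `x` a motif point; a
finite surgery on `Q − x` (`xf ⊆ Q − x` removed, `R` inserted off the rest) whose truncated balance at radius `Rc ≥ δ`, loaded with
`(n + k)·T(δ, Rc)`, is below `e(Q)·(k − n)` certifies `e⋆ < e(Q)`.  No bound on `e⋆` is needed. [folklore] -/
theorem eStar_lt_energyPerParticle_of_truncated_surgery (Q : PeriodicConfiguration 3)
    (hDoor : Summit.AtomisticToContinuum.Crystallization.Theses.GrainCoreNetworkSplit.MuEquilibriumDoor)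
    (hδ : 0 < δ) (hsep : ∀ p ∈ Q.points, ∀ q ∈ Q.points, p ≠ q → δ ≤ dist p q)
    {x : E3} (hx : x ∈ Q.motif) {n : ℕ} {xf : Fin n → E3} (hxf : Function.Injective xf) (hX : Set.range xf ⊆ view Q x)
    {k : ℕ} {R : Fin k → E3} (hR : Function.Injective R) (hdisj : Disjoint (Set.range R) (view Q x \ Set.range xf))
    {Rc : ℝ} (hRc : δ ≤ Rc) (tf : Fin n → Finset E3) (htf : ∀ i, ∀ y : E3, y ∈ tf i ↔ y ∈ view Q x \ Set.range xf ∧ dist (xf i) y ≤ Rc)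
    (tR : Fin k → Finset E3) (htR : ∀ i, ∀ y : E3, y ∈ tR i ↔ y ∈ view Q x \ Set.range xf ∧ dist (R i) y ≤ Rc)
    (hΔ : (interactionEnergy lennardJones R + ∑ i, ∑ y ∈ tR i, lennardJones (dist (R i) y)) -
        (interactionEnergy lennardJones xf + ∑ i, ∑ y ∈ tf i, lennardJones (dist (xf i) y)) +
        ((n : ℝ) + k) * ((δ⁻¹ ^ 6 / 12 + 1 / 6) * (1024 / (δ ^ 3 * Rc ^ 3))) <
        Q.energyPerParticle lennardJones * ((k : ℝ) - n)) :
    (⨅ Q' : PeriodicConfiguration 3, Q'.energyPerParticle lennardJones) < Q.energyPerParticle lennardJones := by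
  by_contra hle
  rw [not_lt] at hle
  have heq : Q.energyPerParticle lennardJones = ⨅ Q' : PeriodicConfiguration 3, Q'.energyPerParticle lennardJones :=
    le_antisymm hle (eStar_le Q)
  have hG := isMuGSC_view_of_le Q hDoor hδ hsep hle x hx
  rw [← heq] at hG
  exact not_isMuGSC_of_truncated_surgery hδ (view_separated Q hsep x) hxf hX hR hdisj hRc tf htf tR htR hΔ hG

end Summit.AtomisticToContinuum.Crystallization.Theorems.FrustratedLawDichotomyGSCSurgeryCertificates

end
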